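import Summits.QuantumFields.BalabanUV.Beta.GAN24.DirichletRingWirtinger
import Summits.QuantumFields.BalabanUV.Beta.GAN24.DirichletRingPoincare

/-!
# `BalabanUV.Beta.GAN24.DirichletRingPath` — binder row G-an2-4 / (CONV-C), road P2 PART IV, leaf L3 of the ring lemma: RING COMBINATORICS
# AT A RE-ENTRANT BLOCK VERTEX (the bond partition `E_{k+1} = E_k + R + T_{k+1}` and the ring path; unit b2b-balaban-gan24-formalise-leaf-06,
# gen 30, v1; part 1 of 2 — part 2 `DirichletRingFlux` = leaf L5)

HONEST FRAMING (cell contract, verbatim): «discharging `BetaPertH` makes Bałaban's UV stability UNCONDITIONAL — a real constructive-QFT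
result; it is NOT the continuum limit and NOT the Clay problem.»  Pure finite-sum brick for the ring lemma of the road-P2 owner's memo
`HOME/b2b-balaban-gan24-p2/gen24/W-FULL-WEIGHTED.md` §3 (leaf L3 «ring combinatorics at a block vertex»; the leaves were opened to any seat by
the owner, journal l.21766), in CHART COORDINATES: the lattice square `Q_k(c) = [−k,k)²` around a re-entrant vertex `c = (−½,−½)` is written on
`ℤ × ℤ` (curried field `U : ℤ → ℤ → ℂ`); the block NOT in `Ω` is the quadrant `{0 ≤ s} × {0 ≤ t}`, where `U` vanishes (hypothesis
`hU : ∀ s t, 0 ≤ s → 0 ≤ t → U s t = 0`, displayed in every theorem that needs it).  Leaf L6 (`DirichletRingPoincare`, an `ℕ × ℕ` square) is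
this square shifted by `k`; the L8 assembler pulls the torus field back along `x ↦ c + x` for both.
Objects (all sums over `Finset.range` with displayed integer offsets; site `(i − k, j − k)`, `i, j < 2k`):
 * `hb U s t = ‖U(s+1,t) − U(s,t)‖²`, `vb U s t = ‖U(s,t+1) − U(s,t)‖²` (bond energies);
 * `Ering k U` = `E_k`: all bonds with both ends in `Q_k` (the bonds into the zero block included — they are the Dirichlet energy);
 * `Rring k U` = the `8k` OUTWARD bonds of `Q_k` (the memo's `R_{k+1}`); `Tring k U` = the `8k − 4` TANGENTIAL bonds of the ring `∂Q_k = Q_k ∖ Q_{k−1}`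
   (the memo's `T_k`);
 * `outNorm k U` = `Σ_{outward bonds b} ‖U(x_b)‖²` (inner endpoints; corner sites twice); `flux k U` = `Σ_b Ū(x_b)(U(x_b) − U(y_b))` = the boundary
   terms of the Green identity L4 (`DirichletRingGreen.sum_conj_mul_Pdir_eq` at `A = Q_k(c)`, both directions) pulled back;
 * `cRing k = (6k−2)²/π² + 1/6 + (9k − 3)` (the memo's `c_k²`, with L2's explicit Wirtinger constant for the `6k − 2`-edge path);
 * `ringPath k` / `pathVal k U` = the lattice path through the `6k − 3` ring sites outside the quadrant, from the zero site `(k−1,0)` down the right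
   column to `(k−1,−k)` (`i = k`), along the bottom row to `(−k,−k)` (`i = 3k−1`), up the left column to `(−k,k−1)` (`i = 5k−2`), along the top row to
   the zero site `(0,k−1)` (`i = 6k−2`).
Theorems: (L3a) **`Ering_succ`** `Ering (k+1) U = Ering k U + Rring k U + Tring (k+1) U` (the memo's `Ẽ_k − Ẽ_{k−1} = ΔẼ_k` with `Ẽ = E + R`);
(L3b) `pathVal_zero/_last` (zero ends), `pathVal_seg1…4` (the four sides), **`pathEnergy_le_Tring`** (the path's `6k − 2` edges are distinct
tangential ring bonds), **`outNorm_eq_pathNorm_add_corners`** (each ring site once along the path + the three corners in `Ω` once more).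

ABSOLUTE RULE (cell, verbatim): «No internally-minted statement may enter as a cited fact. Every hypothesis is either kernel-proved in
this package or a verbatim quotation of a PUBLISHED theorem with page reference. The manuscript(s) under audit are NOT citable for
their own disputed steps — they are the thing under adjudication; programme-internal (2001/route/tribunal) claims are never citable.»
[folklore] finite sums; nothing printed is a hypothesis; the `def`s are [our object] names of displayed finite sums (no `def … : Prop`).  NOT CLAIMED:
the flux bound (L5, part 2), L8 (`D₂`), (A)/(B), the weighted END, NE2, (CONV-C), `BetaPertH`, continuum, Clay.  «not in print; our proof attempt».
HONEST DEPENDENCY: continuum YM on T⁴ ⇐ BetaPertH ∧ nine spine estimates (0/9 proved); BetaPertH ⇐ (D1) ∧ (D4) ∧ CAP+tail; G-an2-4 gates asym,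
D1 and NE2/3/4.
-/

noncomputable section

open scoped BigOperators ComplexConjugate
open Finset

namespace Summit.QuantumFields.BalabanUV.Beta.GAN24.DirichletRingPath

/-! ## §0 The objects: bond energies of the square `Q_k = [−k,k)²` in chart coordinates -/

/-- [our object] horizontal bond energy at `(s,t)`: `‖U(s+1,t) − U(s,t)‖²`. -/
def hb (U : ℤ → ℤ → ℂ) (s t : ℤ) : ℝ := ‖U (s + 1) t - U s t‖ ^ 2

/-- [our object] vertical bond energy at `(s,t)`: `‖U(s,t+1) − U(s,t)‖²`. -/
def vb (U : ℤ → ℤ → ℂ) (s t : ℤ) : ℝ := ‖U s (t + 1) - U s t‖ ^ 2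

/-- [our object] `E_k`: the energy of all bonds with both endpoints in `Q_k = [−k,k)²` (site `(i − k, j − k)`, `i, j < 2k`). -/
def Ering (k : ℕ) (U : ℤ → ℤ → ℂ) : ℝ :=
  (∑ i ∈ range (2 * k - 1), ∑ j ∈ range (2 * k), hb U ((i : ℤ) - k) ((j : ℤ) - k))
    + ∑ i ∈ range (2 * k), ∑ j ∈ range (2 * k - 1), vb U ((i : ℤ) - k) ((j : ℤ) - k)

/-- [our object] the `8k` OUTWARD bonds of `Q_k` (right column `(k−1,t)–(k,t)`, left `(−k−1,t)–(−k,t)`, top `(s,k−1)–(s,k)`, bottom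
`(s,−k−1)–(s,−k)`): the memo's `R_{k+1}`-sum. -/
def Rring (k : ℕ) (U : ℤ → ℤ → ℂ) : ℝ :=
  ∑ j ∈ range (2 * k), (hb U ((k : ℤ) - 1) ((j : ℤ) - k) + hb U (-(k : ℤ) - 1) ((j : ℤ) - k)
    + vb U ((j : ℤ) - k) ((k : ℤ) - 1) + vb U ((j : ℤ) - k) (-(k : ℤ) - 1))

/-- [our object] the `8k − 4` TANGENTIAL bonds of the ring `∂Q_k = Q_k ∖ Q_{k−1}` (top row `t = k−1`, bottom row `t = −k`, right column
`s = k−1`, left column `s = −k`): the memo's `T_k`-sum. -/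
def Tring (k : ℕ) (U : ℤ → ℤ → ℂ) : ℝ :=
  ∑ i ∈ range (2 * k - 1), (hb U ((i : ℤ) - k) ((k : ℤ) - 1) + hb U ((i : ℤ) - k) (-(k : ℤ))
    + vb U ((k : ℤ) - 1) ((i : ℤ) - k) + vb U (-(k : ℤ)) ((i : ℤ) - k))

/-- [our object] `Σ_{outward bonds b} ‖U(x_b)‖²` (`x_b` the endpoint in `Q_k`; corner sites are counted twice). -/
def outNorm (k : ℕ) (U : ℤ → ℤ → ℂ) : ℝ :=
  ∑ j ∈ range (2 * k), (‖U ((k : ℤ) - 1) ((j : ℤ) - k)‖ ^ 2 + ‖U (-(k : ℤ)) ((j : ℤ) - k)‖ ^ 2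
    + ‖U ((j : ℤ) - k) ((k : ℤ) - 1)‖ ^ 2 + ‖U ((j : ℤ) - k) (-(k : ℤ))‖ ^ 2)

/-- [our object] the FLUX through `∂Q_k`: `Σ_{outward bonds b} Ū(x_b)·(U(x_b) − U(y_b))` — the boundary terms of L4's Green identity at
`A = Q_k(c)` (both directions), in chart coordinates. -/
def flux (k : ℕ) (U : ℤ → ℤ → ℂ) : ℂ :=
  ∑ j ∈ range (2 * k),
    (conj (U ((k : ℤ) - 1) ((j : ℤ) - k)) * (U ((k : ℤ) - 1) ((j : ℤ) - k) - U k ((j : ℤ) - k))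
      + conj (U (-(k : ℤ)) ((j : ℤ) - k)) * (U (-(k : ℤ)) ((j : ℤ) - k) - U (-(k : ℤ) - 1) ((j : ℤ) - k))
      + conj (U ((j : ℤ) - k) ((k : ℤ) - 1)) * (U ((j : ℤ) - k) ((k : ℤ) - 1) - U ((j : ℤ) - k) k)
      + conj (U ((j : ℤ) - k) (-(k : ℤ))) * (U ((j : ℤ) - k) (-(k : ℤ)) - U ((j : ℤ) - k) (-(k : ℤ) - 1)))

/-- [our object] the constant `c_k²` of the flux bound: L2's explicit Wirtinger constant for the path of `6k − 2` edges plus the corner weight `9k − 3`. -/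
def cRing (k : ℕ) : ℝ := (6 * (k : ℝ) - 2) ^ 2 / Real.pi ^ 2 + 1 / 6 + (9 * (k : ℝ) - 3)

/-- bond energies are nonnegative. -/
theorem hb_nonneg (U : ℤ → ℤ → ℂ) (s t : ℤ) : 0 ≤ hb U s t := sq_nonneg _
/-- bond energies are nonnegative. -/
theorem vb_nonneg (U : ℤ → ℤ → ℂ) (s t : ℤ) : 0 ≤ vb U s t := sq_nonneg _

/-- `0 ≤ T_k`. -/
theorem Tring_nonneg (k : ℕ) (U : ℤ → ℤ → ℂ) : 0 ≤ Tring k U :=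
  Finset.sum_nonneg fun _ _ => by unfold hb vb; positivity

/-- `0 ≤ R`. -/
theorem Rring_nonneg (k : ℕ) (U : ℤ → ℤ → ℂ) : 0 ≤ Rring k U :=
  Finset.sum_nonneg fun _ _ => by unfold hb vb; positivity

/-- `0 < c_k²` for `k ≥ 1`. -/
theorem cRing_pos {k : ℕ} (hk : 1 ≤ k) : 0 < cRing k := by
  have hkR : (1 : ℝ) ≤ k := by exact_mod_cast hk
  have h1 : 0 ≤ (6 * (k : ℝ) - 2) ^ 2 / Real.pi ^ 2 := by positivity
  unfold cRing; linarith

/-! ## §1 (L3a) The bond partition `E_{k+1} = E_k + R_{k+1} + T_{k+1}` -/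

/-- re-indexing helper: `Σ_{i<n+1} f(i − (k+1)) = f(−k−1) + Σ_{i<n} f(i − k)`. [folklore] -/
theorem sum_range_succ_shift {M : Type*} [AddCommMonoid M] (f : ℤ → M) (n k : ℕ) :
    ∑ i ∈ range (n + 1), f ((i : ℤ) - ((k : ℤ) + 1)) = f (-(k : ℤ) - 1) + ∑ i ∈ range n, f ((i : ℤ) - k) := by
  rw [Finset.sum_range_succ', add_comm]
  congr 1
  · congr 1; push_cast; ring
  · refine Finset.sum_congr rfl fun i _ => ?_
    congr 1; push_cast; ring

/-- peeling helper: `Σ_{i<n+2} f(i − (k+1)) = f(−k−1) + f(n − k) + Σ_{i<n} f(i − k)` (bottom and top terms off, the rest shifted).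
[folklore] -/
theorem sum_range_peel {M : Type*} [AddCommMonoid M] (f : ℤ → M) (n k : ℕ) :
    ∑ i ∈ range (n + 2), f ((i : ℤ) - ((k : ℤ) + 1)) = f (-(k : ℤ) - 1) + f ((n : ℤ) - k) + ∑ i ∈ range n, f ((i : ℤ) - k) := by
  rw [Finset.sum_range_succ, sum_range_succ_shift, add_assoc, add_comm (∑ i ∈ range n, f ((i : ℤ) - k)), ← add_assoc]
  congr 2; push_cast; ring

/-- **(L3a) THE BOND PARTITION OF `Q_{k+1}`**: bonds with both ends in `Q_{k+1}` = bonds with both ends in `Q_k` ⊔ the outward bonds of `Q_k`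
⊔ the tangential bonds of the ring `∂Q_{k+1}`; hence `E_{k+1} = E_k + R + T_{k+1}` (the memo's `Ẽ_k − Ẽ_{k−1} = ΔẼ_k`; at `k = 0`:
`Q_0 = ∅` and all four bonds of `Q_1` are tangential). [folklore] -/
theorem Ering_succ (k : ℕ) (U : ℤ → ℤ → ℂ) :
    Ering (k + 1) U = Ering k U + Rring k U + Tring (k + 1) U := by
  rcases Nat.eq_zero_or_pos k with rfl | hk
  · simp only [Ering, Rring, Tring, Finset.sum_range_succ, Finset.sum_range_zero, Nat.mul_zero, Nat.zero_sub, Nat.mul_one,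
      zero_add]
    push_cast; ring_nf
  obtain ⟨k', rfl⟩ : ∃ k', k = k' + 1 := ⟨k - 1, by omega⟩
  simp only [Ering, Rring, Tring, Finset.sum_add_distrib]
  have e1 : 2 * (k' + 1 + 1) - 1 = (2 * k' + 1) + 2 := by omega
  have e2 : 2 * (k' + 1 + 1) = (2 * k' + 2) + 2 := by omega
  have e3 : 2 * (k' + 1) - 1 = 2 * k' + 1 := by omega
  have e4 : 2 * (k' + 1) = 2 * k' + 2 := by omega
  have ec : ((k' + 1 + 1 : ℕ) : ℤ) = ((k' + 1 : ℕ) : ℤ) + 1 := by push_cast; ring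
  rw [e1, e2, e3, e4, ec]
  -- horizontal bonds: peel the `j`-range (bottom/top rows of the ring `∂Q_{k+1}`), then the `i`-range (left/right outward bonds of `Q_k`)
  have hH : ∑ i ∈ range (2 * k' + 1 + 2), ∑ j ∈ range (2 * k' + 2 + 2), hb U ((i : ℤ) - ((↑(k' + 1) : ℤ) + 1)) ((j : ℤ) - ((↑(k' + 1) : ℤ) + 1))
      = (∑ i ∈ range (2 * k' + 1 + 2), hb U ((i : ℤ) - ((↑(k' + 1) : ℤ) + 1)) (((↑(k' + 1) : ℤ) + 1) - 1)
          + ∑ i ∈ range (2 * k' + 1 + 2), hb U ((i : ℤ) - ((↑(k' + 1) : ℤ) + 1)) (-((↑(k' + 1) : ℤ) + 1)))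
        + (∑ j ∈ range (2 * k' + 2), hb U ((↑(k' + 1) : ℤ) - 1) ((j : ℤ) - ↑(k' + 1))
          + ∑ j ∈ range (2 * k' + 2), hb U (-(↑(k' + 1) : ℤ) - 1) ((j : ℤ) - ↑(k' + 1)))
        + ∑ i ∈ range (2 * k' + 1), ∑ j ∈ range (2 * k' + 2), hb U ((i : ℤ) - ↑(k' + 1)) ((j : ℤ) - ↑(k' + 1)) := by
    rw [Finset.sum_congr rfl fun (i : ℕ) _ => sum_range_peel (fun t => hb U ((i : ℤ) - ((↑(k' + 1) : ℤ) + 1)) t) (2 * k' + 2) (k' + 1),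
      Finset.sum_add_distrib, Finset.sum_add_distrib,
      sum_range_peel (fun s => ∑ j ∈ range (2 * k' + 2), hb U s ((j : ℤ) - ↑(k' + 1))) (2 * k' + 1) (k' + 1)]
    have a1 : ∀ i : ℕ, hb U ((i : ℤ) - ((↑(k' + 1) : ℤ) + 1)) (-(↑(k' + 1) : ℤ) - 1)
        = hb U ((i : ℤ) - ((↑(k' + 1) : ℤ) + 1)) (-((↑(k' + 1) : ℤ) + 1)) := fun i => by
      rw [show (-(↑(k' + 1) : ℤ) - 1) = -((↑(k' + 1) : ℤ) + 1) by ring]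
    have a2 : ∀ i : ℕ, hb U ((i : ℤ) - ((↑(k' + 1) : ℤ) + 1)) (((2 * k' + 2 : ℕ) : ℤ) - ↑(k' + 1))
        = hb U ((i : ℤ) - ((↑(k' + 1) : ℤ) + 1)) (((↑(k' + 1) : ℤ) + 1) - 1) := fun i => by
      rw [show (((2 * k' + 2 : ℕ) : ℤ) - ↑(k' + 1)) = ((↑(k' + 1) : ℤ) + 1) - 1 by push_cast; ring]
    have a3 : (((2 * k' + 1 : ℕ) : ℤ) - ↑(k' + 1)) = ((↑(k' + 1) : ℤ) - 1) := by push_cast; ring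
    simp_rw [a1, a2, a3]
    ring
  -- vertical bonds: peel the `i`-range (left/right columns of the ring), then the `j`-range (bottom/top outward bonds)
  have hV : ∑ i ∈ range (2 * k' + 2 + 2), ∑ j ∈ range (2 * k' + 1 + 2), vb U ((i : ℤ) - ((↑(k' + 1) : ℤ) + 1)) ((j : ℤ) - ((↑(k' + 1) : ℤ) + 1))
      = (∑ i ∈ range (2 * k' + 1 + 2), vb U (((↑(k' + 1) : ℤ) + 1) - 1) ((i : ℤ) - ((↑(k' + 1) : ℤ) + 1))
          + ∑ i ∈ range (2 * k' + 1 + 2), vb U (-((↑(k' + 1) : ℤ) + 1)) ((i : ℤ) - ((↑(k' + 1) : ℤ) + 1)))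
        + ((∑ j ∈ range (2 * k' + 2), vb U ((j : ℤ) - ↑(k' + 1)) ((↑(k' + 1) : ℤ) - 1)
            + ∑ j ∈ range (2 * k' + 2), vb U ((j : ℤ) - ↑(k' + 1)) (-(↑(k' + 1) : ℤ) - 1))
          + ∑ i ∈ range (2 * k' + 2), ∑ j ∈ range (2 * k' + 1), vb U ((i : ℤ) - ↑(k' + 1)) ((j : ℤ) - ↑(k' + 1))) := by
    rw [sum_range_peel (fun s => ∑ j ∈ range (2 * k' + 1 + 2), vb U s ((j : ℤ) - ((↑(k' + 1) : ℤ) + 1))) (2 * k' + 2) (k' + 1),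
      Finset.sum_congr rfl fun (i : ℕ) _ => sum_range_peel (fun t => vb U ((i : ℤ) - ↑(k' + 1)) t) (2 * k' + 1) (k' + 1),
      Finset.sum_add_distrib, Finset.sum_add_distrib]
    have b1 : ∀ j : ℕ, vb U (-(↑(k' + 1) : ℤ) - 1) ((j : ℤ) - ((↑(k' + 1) : ℤ) + 1))
        = vb U (-((↑(k' + 1) : ℤ) + 1)) ((j : ℤ) - ((↑(k' + 1) : ℤ) + 1)) := fun j => by
      rw [show (-(↑(k' + 1) : ℤ) - 1) = -((↑(k' + 1) : ℤ) + 1) by ring]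
    have b2 : (((2 * k' + 2 : ℕ) : ℤ) - ↑(k' + 1)) = ((↑(k' + 1) : ℤ) + 1) - 1 := by push_cast; ring
    have b3 : (((2 * k' + 1 : ℕ) : ℤ) - ↑(k' + 1)) = ((↑(k' + 1) : ℤ) - 1) := by push_cast; ring
    simp_rw [b1, b2, b3]
    ring
  rw [hH, hV]
  ring

/-! ## §2 (L3b) The ring path -/

/-- [our object] the lattice path through the ring `∂Q_k` outside the quadrant: `i = 0 ↦ (k−1, 0)` (zero site), down the right column to
`(k−1,−k)` (`i = k`), along the bottom row to `(−k,−k)` (`i = 3k−1`), up the left column to `(−k,k−1)` (`i = 5k−2`), along the top row to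
the zero site `(0,k−1)` (`i = 6k−2`). -/
def ringPath (k i : ℕ) : ℤ × ℤ :=
  if i ≤ k then ((k : ℤ) - 1, -(i : ℤ))
  else if i + 1 ≤ 3 * k then (2 * (k : ℤ) - 1 - i, -(k : ℤ))
  else if i + 2 ≤ 5 * k then (-(k : ℤ), (i : ℤ) - 4 * k + 1)
  else ((i : ℤ) - 6 * k + 2, (k : ℤ) - 1)

/-- [our object] the field along the ring path. -/
def pathVal (k : ℕ) (U : ℤ → ℤ → ℂ) (i : ℕ) : ℂ := U (ringPath k i).1 (ringPath k i).2

/-- the right column of the path (`i ≤ k`). -/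
theorem ringPath_seg1 {k i : ℕ} (hi : i ≤ k) : ringPath k i = ((k : ℤ) - 1, -(i : ℤ)) := by
  simp [ringPath, hi]

/-- the bottom row of the path (`k ≤ i ≤ 3k−1`). -/
theorem ringPath_seg2 {k i : ℕ} (h1 : k ≤ i) (h2 : i + 1 ≤ 3 * k) : ringPath k i = (2 * (k : ℤ) - 1 - i, -(k : ℤ)) := by
  by_cases hi : i ≤ k
  · have : i = k := le_antisymm hi h1
    subst this
    rw [ringPath_seg1 le_rfl]; ext <;> push_cast <;> ring
  · simp [ringPath, hi, h2]

/-- the left column of the path (`3k−1 ≤ i ≤ 5k−2`). -/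
theorem ringPath_seg3 {k i : ℕ} (h1 : 3 * k ≤ i + 1) (h2 : i + 2 ≤ 5 * k) : ringPath k i = (-(k : ℤ), (i : ℤ) - 4 * k + 1) := by
  by_cases hi : i + 1 ≤ 3 * k
  · have hik : i + 1 = 3 * k := le_antisymm hi h1
    have hk : 1 ≤ k := by omega
    rw [ringPath_seg2 (by omega) hi]
    have : (i : ℤ) = 3 * k - 1 := by
      have := congrArg (fun n : ℕ => (n : ℤ)) hik; push_cast at this; linarith
    ext <;> simp only [] <;> rw [this] <;> ring
  · have hi' : ¬ i ≤ k := by omega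
    simp [ringPath, hi, hi', h2]

/-- the top row of the path (`5k−2 ≤ i`, `k ≥ 1`). -/
theorem ringPath_seg4 {k i : ℕ} (hk : 1 ≤ k) (h1 : 5 * k ≤ i + 2) : ringPath k i = ((i : ℤ) - 6 * k + 2, (k : ℤ) - 1) := by
  by_cases hi : i + 2 ≤ 5 * k
  · have hik : i + 2 = 5 * k := le_antisymm hi h1
    rw [ringPath_seg3 (by omega) hi]
    have : (i : ℤ) = 5 * k - 2 := by
      have := congrArg (fun n : ℕ => (n : ℤ)) hik; push_cast at this; linarith
    ext <;> simp only [] <;> rw [this] <;> ring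
  · have hi' : ¬ i ≤ k := by omega
    have hi'' : ¬ i + 1 ≤ 3 * k := by omega
    simp [ringPath, hi, hi', hi'']

/-- segment 1 in field form: `g i = U(k−1, t)` with `t = −i` (`i ≤ k`). -/
theorem pathVal_seg1 {k i : ℕ} (U : ℤ → ℤ → ℂ) (hi : i ≤ k) (t : ℤ) (ht : t = -(i : ℤ)) :
    pathVal k U i = U ((k : ℤ) - 1) t := by
  rw [pathVal, ringPath_seg1 hi, ht]

/-- segment 2 in field form: `g i = U(s, −k)` with `s = 2k − 1 − i` (`k ≤ i ≤ 3k − 1`). -/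
theorem pathVal_seg2 {k i : ℕ} (U : ℤ → ℤ → ℂ) (h1 : k ≤ i) (h2 : i + 1 ≤ 3 * k) (s : ℤ) (hs : s = 2 * (k : ℤ) - 1 - i) :
    pathVal k U i = U s (-(k : ℤ)) := by
  rw [pathVal, ringPath_seg2 h1 h2, hs]

/-- segment 3 in field form: `g i = U(−k, t)` with `t = i − 4k + 1` (`3k − 1 ≤ i ≤ 5k − 2`). -/
theorem pathVal_seg3 {k i : ℕ} (U : ℤ → ℤ → ℂ) (h1 : 3 * k ≤ i + 1) (h2 : i + 2 ≤ 5 * k) (t : ℤ) (ht : t = (i : ℤ) - 4 * k + 1) :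
    pathVal k U i = U (-(k : ℤ)) t := by
  rw [pathVal, ringPath_seg3 h1 h2, ht]

/-- segment 4 in field form: `g i = U(s, k−1)` with `s = i − 6k + 2` (`5k − 2 ≤ i`, `k ≥ 1`). -/
theorem pathVal_seg4 {k i : ℕ} (U : ℤ → ℤ → ℂ) (hk : 1 ≤ k) (h1 : 5 * k ≤ i + 2) (s : ℤ) (hs : s = (i : ℤ) - 6 * k + 2) :
    pathVal k U i = U s ((k : ℤ) - 1) := by
  rw [pathVal, ringPath_seg4 hk h1, hs]

/-- the path starts at the zero site `(k−1, 0)`. -/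
theorem pathVal_zero {k : ℕ} (hk : 1 ≤ k) {U : ℤ → ℤ → ℂ} (hU : ∀ s t : ℤ, 0 ≤ s → 0 ≤ t → U s t = 0) : pathVal k U 0 = 0 := by
  rw [pathVal_seg1 U (Nat.zero_le _) 0 (by simp)]
  have hkR : (1 : ℤ) ≤ k := by exact_mod_cast hk
  exact hU _ _ (by linarith) le_rfl

/-- the path ends at the zero site `(0, k−1)` after `6k − 2` edges. -/
theorem pathVal_last {k : ℕ} (hk : 1 ≤ k) {U : ℤ → ℤ → ℂ} (hU : ∀ s t : ℤ, 0 ≤ s → 0 ≤ t → U s t = 0) : pathVal k U (6 * k - 2) = 0 := by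
  rw [pathVal_seg4 U hk (by omega) 0 (by omega)]
  have hkR : (1 : ℤ) ≤ k := by exact_mod_cast hk
  exact hU _ _ le_rfl (by linarith)

/-- reflection helper: `Σ_{j<n} f(a − j) = Σ_{j<n} f(a + 1 − n + j)`. [folklore] -/
theorem sum_range_reflect' {M : Type*} [AddCommMonoid M] (f : ℤ → M) (a : ℤ) :
    ∀ n : ℕ, ∑ j ∈ range n, f (a - j) = ∑ j ∈ range n, f (a + 1 - n + j)
  | 0 => by simp
  | n + 1 => by
    rw [Finset.sum_range_succ, Finset.sum_range_succ' (fun j => f (a + 1 - ↑(n + 1) + ↑j)), sum_range_reflect' f a n]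
    congr 1
    · refine Finset.sum_congr rfl fun j _ => ?_
      congr 1; push_cast; ring
    · congr 1; push_cast; ring

/-- **the path's edges are distinct tangential ring bonds**: `Σ_{i<6k−2} ‖g(i+1) − g(i)‖² ≤ Tring k U`. [folklore] -/
theorem pathEnergy_le_Tring {k : ℕ} (hk : 1 ≤ k) (U : ℤ → ℤ → ℂ) :
    ∑ i ∈ range (6 * k - 2), ‖pathVal k U (i + 1) - pathVal k U i‖ ^ 2 ≤ Tring k U := by
  have hsplit : 6 * k - 2 = ((k + (2 * k - 1)) + (2 * k - 1)) + k := by omega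
  rw [hsplit, Finset.sum_range_add, Finset.sum_range_add, Finset.sum_range_add]
  -- segment 1 (right column, downwards): `vb U (k−1) (−1−i)`, `i < k`, = `vb U (k−1) (j−k)` reflected
  have s1 : ∑ i ∈ range k, ‖pathVal k U (i + 1) - pathVal k U i‖ ^ 2 = ∑ i ∈ range k, vb U ((k : ℤ) - 1) ((i : ℤ) - k) := by
    have : ∑ i ∈ range k, ‖pathVal k U (i + 1) - pathVal k U i‖ ^ 2 = ∑ i ∈ range k, vb U ((k : ℤ) - 1) (-1 - (i : ℤ)) := by
      refine Finset.sum_congr rfl fun i hi => ?_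
      have hi := Finset.mem_range.mp hi
      rw [pathVal_seg1 U (by omega : i + 1 ≤ k) (-1 - (i : ℤ)) (by push_cast; ring),
        pathVal_seg1 U (by omega : i ≤ k) (-1 - (i : ℤ) + 1) (by ring), vb, norm_sub_rev]
    rw [this, sum_range_reflect' (fun t => vb U ((k : ℤ) - 1) t) (-1) k]
    refine Finset.sum_congr rfl fun i _ => ?_
    congr 1; ring
  -- segment 2 (bottom row, leftwards): `hb U (k−2−i) (−k)`, `i < 2k−1`, = `hb U (j−k) (−k)` reflected
  have s2 : ∑ i ∈ range (2 * k - 1), ‖pathVal k U (k + i + 1) - pathVal k U (k + i)‖ ^ 2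
      = ∑ i ∈ range (2 * k - 1), hb U ((i : ℤ) - k) (-(k : ℤ)) := by
    have : ∑ i ∈ range (2 * k - 1), ‖pathVal k U (k + i + 1) - pathVal k U (k + i)‖ ^ 2
        = ∑ i ∈ range (2 * k - 1), hb U (((k : ℤ) - 2) - (i : ℤ)) (-(k : ℤ)) := by
      refine Finset.sum_congr rfl fun i hi => ?_
      have hi := Finset.mem_range.mp hi
      rw [pathVal_seg2 U (by omega : k ≤ k + i + 1) (by omega) ((k : ℤ) - 2 - i) (by push_cast; ring),
        pathVal_seg2 U (by omega : k ≤ k + i) (by omega) ((k : ℤ) - 2 - i + 1) (by push_cast; ring), hb, norm_sub_rev]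
    rw [this, sum_range_reflect' (fun s => hb U s (-(k : ℤ))) ((k : ℤ) - 2) (2 * k - 1)]
    refine Finset.sum_congr rfl fun i _ => ?_
    congr 1; omega
  -- segment 3 (left column, upwards): `vb U (−k) (i−k)`, `i < 2k−1`
  have s3 : ∑ i ∈ range (2 * k - 1), ‖pathVal k U (k + (2 * k - 1) + i + 1) - pathVal k U (k + (2 * k - 1) + i)‖ ^ 2
      = ∑ i ∈ range (2 * k - 1), vb U (-(k : ℤ)) ((i : ℤ) - k) := by
    refine Finset.sum_congr rfl fun i hi => ?_
    have hi := Finset.mem_range.mp hi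
    rw [pathVal_seg3 U (by omega) (by omega) ((i : ℤ) - k + 1) (by omega), pathVal_seg3 U (by omega) (by omega) ((i : ℤ) - k) (by omega), vb]
  -- segment 4 (top row, rightwards): `hb U (i−k) (k−1)`, `i < k`
  have s4 : ∑ i ∈ range k, ‖pathVal k U (k + (2 * k - 1) + (2 * k - 1) + i + 1) - pathVal k U (k + (2 * k - 1) + (2 * k - 1) + i)‖ ^ 2
      = ∑ i ∈ range k, hb U ((i : ℤ) - k) ((k : ℤ) - 1) := by
    refine Finset.sum_congr rfl fun i hi => ?_
    have hi := Finset.mem_range.mp hi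
    rw [pathVal_seg4 U hk (by omega) ((i : ℤ) - k + 1) (by omega), pathVal_seg4 U hk (by omega) ((i : ℤ) - k) (by omega), hb]
  rw [s1, s2, s3, s4]
  -- compare with `Tring`: two segments appear verbatim, the two short ones are sub-sums over `range k ⊆ range (2k−1)`
  have hsub : range k ⊆ range (2 * k - 1) := Finset.range_subset_range.mpr (by omega)
  have h1 : ∑ i ∈ range k, vb U ((k : ℤ) - 1) ((i : ℤ) - k) ≤ ∑ i ∈ range (2 * k - 1), vb U ((k : ℤ) - 1) ((i : ℤ) - k) :=
    Finset.sum_le_sum_of_subset_of_nonneg hsub fun _ _ _ => vb_nonneg _ _ _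
  have h4 : ∑ i ∈ range k, hb U ((i : ℤ) - k) ((k : ℤ) - 1) ≤ ∑ i ∈ range (2 * k - 1), hb U ((i : ℤ) - k) ((k : ℤ) - 1) :=
    Finset.sum_le_sum_of_subset_of_nonneg hsub fun _ _ _ => hb_nonneg _ _ _
  simp only [Tring, Finset.sum_add_distrib]
  linarith

/-- splitting helper without touching other occurrences of `2k`: `Σ_{j<2k} f j = Σ_{j<k} f j + Σ_{j<k} f (k+j)`. [folklore] -/
theorem sum_range_two_mul {M : Type*} [AddCommMonoid M] (f : ℕ → M) (k : ℕ) :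
    ∑ j ∈ range (2 * k), f j = ∑ j ∈ range k, f j + ∑ j ∈ range k, f (k + j) := by
  rw [two_mul]; exact Finset.sum_range_add f k k

/-- **each ring site once, the three corners in `Ω` once more**: for `U` vanishing on the quadrant,
`outNorm k U = Σ_{i<6k−2} ‖g i‖² + ‖g k‖² + ‖g(3k−1)‖² + ‖g(5k−2)‖²` (`g = pathVal k U`). [folklore] -/
theorem outNorm_eq_pathNorm_add_corners {k : ℕ} (hk : 1 ≤ k) {U : ℤ → ℤ → ℂ} (hU : ∀ s t : ℤ, 0 ≤ s → 0 ≤ t → U s t = 0) :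
    outNorm k U = (∑ i ∈ range (6 * k - 2), ‖pathVal k U i‖ ^ 2)
      + (‖pathVal k U k‖ ^ 2 + ‖pathVal k U (3 * k - 1)‖ ^ 2 + ‖pathVal k U (5 * k - 2)‖ ^ 2) := by
  have hkZ : (1 : ℤ) ≤ k := by exact_mod_cast hk
  have hsplit : 6 * k - 2 = ((k + (2 * k - 1)) + (2 * k - 1)) + k := by omega
  rw [hsplit, Finset.sum_range_add, Finset.sum_range_add, Finset.sum_range_add]
  -- right column: `Σ_{j<2k} ‖U(k−1, j−k)‖² = Σ_{i<k} ‖g i‖² + ‖g k‖²` (the upper half `j ≥ k` vanishes, `g 0 = 0`)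
  have hR : ∑ j ∈ range (2 * k), ‖U ((k : ℤ) - 1) ((j : ℤ) - k)‖ ^ 2 = (∑ i ∈ range k, ‖pathVal k U i‖ ^ 2) + ‖pathVal k U k‖ ^ 2 := by
    rw [sum_range_two_mul (fun j => ‖U ((k : ℤ) - 1) ((j : ℤ) - k)‖ ^ 2) k]
    have hz : ∑ j ∈ range k, ‖U ((k : ℤ) - 1) (((k + j : ℕ) : ℤ) - k)‖ ^ 2 = 0 := by
      refine Finset.sum_eq_zero fun j _ => ?_
      rw [hU _ _ (by linarith) (by push_cast; linarith), norm_zero, zero_pow two_ne_zero]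
    rw [hz, add_zero, ← Finset.sum_range_succ (fun i => ‖pathVal k U i‖ ^ 2) k]
    have : ∑ i ∈ range (k + 1), ‖pathVal k U i‖ ^ 2 = ∑ i ∈ range (k + 1), ‖U ((k : ℤ) - 1) (0 - (i : ℤ))‖ ^ 2 := by
      refine Finset.sum_congr rfl fun i hi => ?_
      have hi := Finset.mem_range.mp hi
      rw [pathVal_seg1 U (by omega) (0 - (i : ℤ)) (by ring)]
    rw [this, sum_range_reflect' (fun t => ‖U ((k : ℤ) - 1) t‖ ^ 2) 0 (k + 1), Finset.sum_range_succ]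
    have hz' : ‖U ((k : ℤ) - 1) (0 + 1 - ((k + 1 : ℕ) : ℤ) + (k : ℕ))‖ ^ 2 = 0 := by
      rw [hU _ _ (by linarith) (by push_cast; linarith), norm_zero, zero_pow two_ne_zero]
    rw [hz', add_zero]
    refine Finset.sum_congr rfl fun j _ => ?_
    congr 3; push_cast; ring
  -- bottom row: `Σ_{j<2k} ‖U(j−k, −k)‖² = Σ_{i<2k−1} ‖g(k+i)‖² + ‖g(3k−1)‖²`
  have hB : ∑ j ∈ range (2 * k), ‖U ((j : ℤ) - k) (-(k : ℤ))‖ ^ 2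
      = (∑ i ∈ range (2 * k - 1), ‖pathVal k U (k + i)‖ ^ 2) + ‖pathVal k U (3 * k - 1)‖ ^ 2 := by
    have e : 3 * k - 1 = k + (2 * k - 1) := by omega
    rw [e, ← Finset.sum_range_succ (fun i => ‖pathVal k U (k + i)‖ ^ 2) (2 * k - 1), show 2 * k - 1 + 1 = 2 * k by omega]
    have : ∑ i ∈ range (2 * k), ‖pathVal k U (k + i)‖ ^ 2 = ∑ i ∈ range (2 * k), ‖U (((k : ℤ) - 1) - (i : ℤ)) (-(k : ℤ))‖ ^ 2 := by
      refine Finset.sum_congr rfl fun i hi => ?_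
      have hi := Finset.mem_range.mp hi
      rw [pathVal_seg2 U (by omega) (by omega) ((k : ℤ) - 1 - i) (by push_cast; ring)]
    rw [this, sum_range_reflect' (fun s => ‖U s (-(k : ℤ))‖ ^ 2) ((k : ℤ) - 1) (2 * k)]
    refine Finset.sum_congr rfl fun j _ => ?_
    congr 2; push_cast; ring
  -- left column: `Σ_{j<2k} ‖U(−k, j−k)‖² = Σ_{i<2k−1} ‖g(3k−1+i)‖² + ‖g(5k−2)‖²`
  have hL : ∑ j ∈ range (2 * k), ‖U (-(k : ℤ)) ((j : ℤ) - k)‖ ^ 2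
      = (∑ i ∈ range (2 * k - 1), ‖pathVal k U (k + (2 * k - 1) + i)‖ ^ 2) + ‖pathVal k U (5 * k - 2)‖ ^ 2 := by
    have e : 5 * k - 2 = k + (2 * k - 1) + (2 * k - 1) := by omega
    rw [e, ← Finset.sum_range_succ (fun i => ‖pathVal k U (k + (2 * k - 1) + i)‖ ^ 2) (2 * k - 1),
      show 2 * k - 1 + 1 = 2 * k by omega]
    refine Finset.sum_congr rfl fun i hi => ?_
    have hi := Finset.mem_range.mp hi
    rw [pathVal_seg3 U (by omega) (by omega) ((i : ℤ) - k) (by omega)]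
  -- top row: `Σ_{j<2k} ‖U(j−k, k−1)‖² = Σ_{i<k} ‖g(5k−2+i)‖²` (the right half `j ≥ k` vanishes)
  have hT : ∑ j ∈ range (2 * k), ‖U ((j : ℤ) - k) ((k : ℤ) - 1)‖ ^ 2
      = ∑ i ∈ range k, ‖pathVal k U (k + (2 * k - 1) + (2 * k - 1) + i)‖ ^ 2 := by
    rw [sum_range_two_mul (fun j => ‖U ((j : ℤ) - k) ((k : ℤ) - 1)‖ ^ 2) k]
    have hz : ∑ j ∈ range k, ‖U (((k + j : ℕ) : ℤ) - k) ((k : ℤ) - 1)‖ ^ 2 = 0 := by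
      refine Finset.sum_eq_zero fun j _ => ?_
      rw [hU _ _ (by push_cast; linarith) (by linarith), norm_zero, zero_pow two_ne_zero]
    rw [hz, add_zero]
    refine Finset.sum_congr rfl fun i hi => ?_
    have hi := Finset.mem_range.mp hi
    rw [pathVal_seg4 U hk (by omega) ((i : ℤ) - k) (by omega)]
  simp only [outNorm, Finset.sum_add_distrib]
  rw [hR, hL, hT, hB]
  ring

end Summit.QuantumFields.BalabanUV.Beta.GAN24.DirichletRingPath
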